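import Mathlib.RingTheory.Length
import Mathlib.RingTheory.FiniteLength
import Mathlib.RingTheory.Ideal.AssociatedPrime.Finiteness
import Mathlib.Algebra.Module.LocalizedModule.Exact
import Mathlib.RingTheory.Artinian.Module
import Mathlib.RingTheory.Spectrum.Maximal.Basic
import Mathlib.Algebra.Algebra.RestrictScalars
import HarnessLib

/-!
# `ℓ_A(N) = Σ_𝔪 ℓ_A(B ⧸ 𝔪) · ℓ_B(N_𝔪)` for a module of finite length over a semi-local ring

Fulton, *Intersection Theory*, App. A.1: for a (Noetherian) ring `B` and a `B`-module `N` of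
finite length, Lemma A.1.2 gives `ℓ_B(N) = Σ_𝔭 ℓ_{B_𝔭}(N_𝔭)` (sum over the primes, only
maximal ideals contributing), and Lemma A.1.3 gives, for a local homomorphism `A → B` of local
rings with residue field degree `d`, `ℓ_A(M) = d · ℓ_B(M)` (the latter is in Mathlib as
`IsLocalRing.length_restrictScalars`).  For the finite push-forward computations of Fulton
Ch. 1 and Ch. 10 (`f_*[div r] = [div N(r)]`, Prop. 1.4 (b); `f_{t*}[W_t] = deg(W/W') [W'_t]`,
Prop. 10.1 (a)) one needs the two combined over a ring `B` finite over a local `A` (so that `B`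
is semi-local): for a `B`-module `N` of finite length,

`ℓ_A(N) = Σ_{𝔪 ∈ Max B} ℓ_A(B ⧸ 𝔪) · ℓ_B(N_𝔪)`,

where `N_𝔪` is the localisation at `𝔪` (`LocalizedModule`), `ℓ_B(N_𝔪) = ℓ_{B_𝔪}(N_𝔪)`, and
`ℓ_A(B ⧸ 𝔪) = [κ(𝔪) : κ(A)]` when `A` is local with `𝔪` over its maximal ideal.  This file
proves that formula (`Literature.RingTheory.Length.length_eq_finsum_length_localizedModule`)
for any ring homomorphism `A → B` with `B` Noetherian having finitely many maximal ideals, by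
dévissage along Mathlib's prime filtration
(`IsNoetherianRing.induction_on_isQuotientEquivQuotientPrime`): both sides vanish on `0`, are
additive in short exact sequences (localisation is exact, `LocalizedModule.map_exact`), and agree
on `B ⧸ 𝔪₀` for `𝔪₀` maximal (`(B ⧸ 𝔪₀)_𝔪 = 0` for `𝔪 ≠ 𝔪₀`, `(B ⧸ 𝔪₀)_{𝔪₀} = B ⧸ 𝔪₀`);
a factor `B ⧸ 𝔭` with `𝔭` not maximal cannot occur in a module of finite length (an Artinian
domain is a field).

## Main results

* `Literature.RingTheory.Length.subsingleton_localizedModule_quotient`,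
  `Literature.RingTheory.Length.length_localizedModule_quotient_self`: localisations of
  `B ⧸ 𝔪₀`.
* `Literature.RingTheory.Length.length_compHom_eq_finsum`: the formula for the `A`-module
  structure through `A → B` (`Module.compHom`).
* `Literature.RingTheory.Length.length_eq_finsum_length_localizedModule`: the formula for any
  compatible `A`-module structure (`IsScalarTower A B N`).

Mathlib has `Module.length` (additivity, `length_eq_zero`, `length_eq_one`),
`IsLocalRing.length_restrictScalars` (Lemma A.1.3), exactness of localisation and the prime
filtration induction; it has no form of Lemma A.1.2 (searched `Module.length` under
`Mathlib/RingTheory`: `Length`, `LocalRing/Length`, `OrderOfVanishing`, `FiniteLength` only).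

## References

* [Fulton1998] W. Fulton, *Intersection Theory*, 2nd ed., Springer (1998), Appendix A.1:
  Lemmas A.1.1–A.1.3.
-/

universe u v w

open Module

namespace Literature.RingTheory.Length

variable {A : Type u} {B : Type v} [CommRing A] [CommRing B] [Algebra A B]

/-! ### Localizations of simple pieces -/

section Pieces

/-- `(B ⧸ 𝔭)_𝔪 = 0` for maximal ideals `𝔪 ≠ 𝔭` (an element of `𝔭 ∖ 𝔪` kills `B ⧸ 𝔭` and acts
invertibly). [folklore] -/
lemma subsingleton_localizedModule_quotient {p m : Ideal B} (hp : p.IsMaximal) [m.IsMaximal]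
    (hne : m ≠ p) : Subsingleton (LocalizedModule m.primeCompl (B ⧸ p)) := by
  -- an element `s ∈ p`, `s ∉ m`
  have hnot : ¬ p ≤ m := fun h ↦ hne (hp.eq_of_le (Ideal.IsMaximal.ne_top ‹_›) h).symm
  obtain ⟨s, hsp, hsm⟩ := Set.not_subset.mp hnot
  have hsm' : s ∈ m.primeCompl := hsm
  have hsb : ∀ b : B ⧸ p, s • b = 0 := fun b ↦ by
    rw [Algebra.smul_def, Ideal.Quotient.algebraMap_eq, Ideal.Quotient.eq_zero_iff_mem.mpr hsp,
      zero_mul]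
  refine ⟨fun x y ↦ ?_⟩
  suffices h0 : ∀ z : LocalizedModule m.primeCompl (B ⧸ p), z = 0 by rw [h0 x, h0 y]
  intro z
  induction z using LocalizedModule.induction_on with
  | h b t =>
    rw [← LocalizedModule.zero_mk t, LocalizedModule.mk_eq]
    refine ⟨⟨s, hsm'⟩, ?_⟩
    change (s : B) • ((t : B) • b) = (s : B) • ((t : B) • (0 : B ⧸ p))
    rw [smul_zero, smul_zero, smul_comm, hsb, smul_zero]

/-- For a maximal ideal `p`, the field `B ⧸ p` is its own localization at `p`: the localization
map `B ⧸ p → (B ⧸ p)_p` is bijective. [folklore] -/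
lemma bijective_mkLinearMap_quotient {p : Ideal B} (hp : p.IsMaximal) :
    Function.Bijective (LocalizedModule.mkLinearMap p.primeCompl (B ⧸ p)) := by
  letI := Ideal.Quotient.field p
  have hunit : ∀ t : p.primeCompl, Ideal.Quotient.mk p (t : B) ≠ 0 := fun t h ↦
    t.2 (Ideal.Quotient.eq_zero_iff_mem.mp h)
  constructor
  · intro x y hxy
    rw [LocalizedModule.mkLinearMap_apply, LocalizedModule.mkLinearMap_apply,
      LocalizedModule.mk_eq] at hxy
    obtain ⟨u, hu⟩ := hxy
    simp only [one_smul] at hu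
    change (u : B) • x = (u : B) • y at hu
    rw [Algebra.smul_def, Algebra.smul_def, Ideal.Quotient.algebraMap_eq] at hu
    exact mul_left_cancel₀ (hunit u) hu
  · intro z
    induction z using LocalizedModule.induction_on with
    | h b t =>
      obtain ⟨t', ht'⟩ := Ideal.Quotient.mk_surjective (Ideal.Quotient.mk p (t : B))⁻¹
      refine ⟨Ideal.Quotient.mk p t' * b, ?_⟩
      rw [LocalizedModule.mkLinearMap_apply, LocalizedModule.mk_eq]
      refine ⟨1, ?_⟩
      simp only [one_smul]
      change (t : B) • (Ideal.Quotient.mk p t' * b) = b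
      rw [Algebra.smul_def, Ideal.Quotient.algebraMap_eq, ← mul_assoc, ht',
        mul_inv_cancel₀ (hunit t), one_mul]

/-- `ℓ_B((B ⧸ p)_p) = 1` for `p` maximal. [folklore] -/
lemma length_localizedModule_quotient_self {p : Ideal B} (hp : p.IsMaximal) :
    Module.length B (LocalizedModule p.primeCompl (B ⧸ p)) = 1 := by
  haveI : IsSimpleModule B (B ⧸ p) :=
    isSimpleModule_iff_quot_maximal.mpr ⟨p, hp, ⟨LinearEquiv.refl B _⟩⟩
  rw [← (LinearEquiv.ofBijective _ (bijective_mkLinearMap_quotient hp)).length_eq,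
    Module.length_eq_one]

/-- A quotient `B ⧸ p` of finite length by a prime `p` is a field, i.e. `p` is maximal
(an Artinian domain is a field). [folklore] -/
lemma isMaximal_of_isFiniteLength_quotient (p : Ideal B) [p.IsPrime]
    (h : IsFiniteLength B (B ⧸ p)) : p.IsMaximal := by
  rw [isFiniteLength_iff_isNoetherian_isArtinian] at h
  obtain ⟨_, hart⟩ := h
  haveI : IsArtinianRing (B ⧸ p) := isArtinian_of_tower B hart
  exact Ideal.Quotient.maximal_of_isField _ (IsArtinianRing.isField_of_isDomain _)

end Pieces

/-! ### The `A`-module structure through `A → B` -/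

section Through

/-- For a `B`-module carrying a compatible `A`-module structure (`IsScalarTower A B P`), the
structure obtained through `A → B` (`Module.compHom`) is the given one. [folklore] -/
lemma compHom_algebraMap_eq (P : Type w) [AddCommGroup P] [Module B P] [Module A P]
    [IsScalarTower A B P] : Module.compHom P (algebraMap A B) = ‹Module A P› :=
  Module.ext' _ _ fun a m ↦ algebraMap_smul B a m

/-- Hence the `A`-lengths agree. [folklore] -/
lemma length_compHom_eq (P : Type w) [AddCommGroup P] [Module B P] [Module A P]
    [IsScalarTower A B P] :
    @Module.length A P _ _ (Module.compHom P (algebraMap A B)) = Module.length A P :=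
  congrArg (fun I : Module A P ↦ @Module.length A P _ _ I) (compHom_algebraMap_eq P)

/-- Additivity of `A`-lengths (through `A → B`) along a short exact sequence of `B`-modules.
[folklore] -/
lemma length_compHom_eq_add_of_exact {N₁ N₂ N₃ : Type*} [AddCommGroup N₁] [Module B N₁]
    [AddCommGroup N₂] [Module B N₂] [AddCommGroup N₃] [Module B N₃] (f : N₁ →ₗ[B] N₂)
    (g : N₂ →ₗ[B] N₃) (hf : Function.Injective f) (hg : Function.Surjective g)
    (hfg : Function.Exact f g) :
    @Module.length A N₂ _ _ (Module.compHom N₂ (algebraMap A B)) =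
      @Module.length A N₁ _ _ (Module.compHom N₁ (algebraMap A B)) +
        @Module.length A N₃ _ _ (Module.compHom N₃ (algebraMap A B)) := by
  letI := Module.compHom N₁ (algebraMap A B)
  letI := Module.compHom N₂ (algebraMap A B)
  letI := Module.compHom N₃ (algebraMap A B)
  let f' : N₁ →ₗ[A] N₂ :=
    { toFun := f, map_add' := f.map_add, map_smul' := fun a x ↦ f.map_smul (algebraMap A B a) x }
  let g' : N₂ →ₗ[A] N₃ :=
    { toFun := g, map_add' := g.map_add, map_smul' := fun a x ↦ g.map_smul (algebraMap A B a) x }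
  exact Module.length_eq_add_of_exact f' g' hf hg hfg

/-- Invariance of `A`-lengths (through `A → B`) under `B`-linear equivalences. [folklore] -/
lemma length_compHom_eq_of_linearEquiv {N₁ N₂ : Type*} [AddCommGroup N₁] [Module B N₁]
    [AddCommGroup N₂] [Module B N₂] (e : N₁ ≃ₗ[B] N₂) :
    @Module.length A N₁ _ _ (Module.compHom N₁ (algebraMap A B)) =
      @Module.length A N₂ _ _ (Module.compHom N₂ (algebraMap A B)) := by
  letI := Module.compHom N₁ (algebraMap A B)
  letI := Module.compHom N₂ (algebraMap A B)
  let e' : N₁ ≃ₗ[A] N₂ :=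
    { e.toAddEquiv with map_smul' := fun a x ↦ e.map_smul (algebraMap A B a) x }
  exact e'.length_eq

end Through

/-! ### The decomposition formula -/

section Main

variable [IsNoetherianRing B] [Finite (MaximalSpectrum B)]

variable (A) in
/-- **Fulton, Intersection Theory, Lemmas A.1.2–A.1.3 (semi-local form).**  Let `A → B` be a
homomorphism of rings with `B` Noetherian with finitely many maximal ideals `𝔪` (e.g. `B`
finite over a local Noetherian `A`), and `N` a `B`-module of finite length. Then
`ℓ_A(N) = Σ_𝔪 ℓ_A(B ⧸ 𝔪) · ℓ_B(N_𝔪)` (and `ℓ_B(N_𝔪) = ℓ_{B_𝔪}(N_𝔪)`): Lemma A.1.2 is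
`ℓ_B(N) = Σ_𝔪 ℓ_{B_𝔪}(N_𝔪)`, and Lemma A.1.3 is `ℓ_A = d · ℓ_{B_𝔪}` along the local
homomorphism `A → B_𝔪` with residue degree `d = [κ(𝔪) : κ(A)]`, which is `ℓ_A(B ⧸ 𝔪)` for `A`
local.  Here the `A`-module structure of `N` is the one through `A → B` (`Module.compHom`); see
`length_eq_finsum_length_localizedModule` for any compatible `A`-structure.  Proof by dévissage
(Mathlib `IsNoetherianRing.induction_on_isQuotientEquivQuotientPrime`): both sides are additive
in short exact sequences (localization is exact), vanish on `0`, and agree on `B ⧸ 𝔪₀`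
(`(B ⧸ 𝔪₀)_𝔪 = 0` for `𝔪 ≠ 𝔪₀` and `(B ⧸ 𝔪₀)_{𝔪₀} = B ⧸ 𝔪₀`); a quotient `B ⧸ 𝔭` of
finite length by a non-maximal prime does not occur (an Artinian domain is a field).
[cite: Fulton1998, Lemma A.1.3] -/
theorem length_compHom_eq_finsum (N : Type w) [AddCommGroup N] [Module B N]
    (hN : IsFiniteLength B N) :
    @Module.length A N _ _ (Module.compHom N (algebraMap A B)) = ∑ᶠ 𝔪 : MaximalSpectrum B,
      Module.length A (B ⧸ 𝔪.asIdeal) *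
        Module.length B (LocalizedModule 𝔪.asIdeal.primeCompl N) := by
  have hfin : Module.Finite B N := by
    rw [isFiniteLength_iff_isNoetherian_isArtinian] at hN
    obtain ⟨_, _⟩ := hN
    exact Module.IsNoetherian.finite B N
  revert hN
  induction hfin using IsNoetherianRing.induction_on_isQuotientEquivQuotientPrime B with
  | subsingleton N =>
    intro _
    letI := Module.compHom N (algebraMap A B)
    rw [Module.length_eq_zero]
    refine (finsum_eq_zero_of_forall_eq_zero fun 𝔪 ↦ ?_).symm
    rw [Module.length_eq_zero (M := LocalizedModule 𝔪.asIdeal.primeCompl N), mul_zero]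
  | quotient N p e =>
    intro hN
    -- `p` is maximal, `B ⧸ p` having finite length
    have hp : p.asIdeal.IsMaximal :=
      isMaximal_of_isFiniteLength_quotient _ (hN.of_surjective (f := e.toLinearMap) e.surjective)
    -- left-hand side: `ℓ_A(N) = ℓ_A(B ⧸ p)`
    have hL : @Module.length A N _ _ (Module.compHom N (algebraMap A B)) =
        Module.length A (B ⧸ p.asIdeal) := by
      rw [length_compHom_eq_of_linearEquiv (A := A) e, length_compHom_eq]
    -- right-hand side: only `𝔪 = p` contributes
    rw [hL, finsum_eq_single _ (⟨p.asIdeal, hp⟩ : MaximalSpectrum B)]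
    · rw [(LinearEquiv.ofBijective (IsLocalizedModule.map p.asIdeal.primeCompl
          (LocalizedModule.mkLinearMap p.asIdeal.primeCompl N)
          (LocalizedModule.mkLinearMap p.asIdeal.primeCompl (B ⧸ p.asIdeal))
          e.toLinearMap) ⟨IsLocalizedModule.map_injective _ _ _ _ e.injective,
          IsLocalizedModule.map_surjective _ _ _ _ e.surjective⟩).length_eq]
      change Module.length A (B ⧸ p.asIdeal) = Module.length A (B ⧸ p.asIdeal) *
        Module.length B (LocalizedModule p.asIdeal.primeCompl (B ⧸ p.asIdeal))
      rw [length_localizedModule_quotient_self hp, mul_one]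
    · intro 𝔪 h𝔪
      have hne : 𝔪.asIdeal ≠ p.asIdeal := fun h ↦ h𝔪 (MaximalSpectrum.ext h)
      haveI := subsingleton_localizedModule_quotient hp (m := 𝔪.asIdeal) hne
      haveI : Subsingleton (LocalizedModule 𝔪.asIdeal.primeCompl N) :=
        (IsLocalizedModule.map_injective 𝔪.asIdeal.primeCompl
          (LocalizedModule.mkLinearMap 𝔪.asIdeal.primeCompl N)
          (LocalizedModule.mkLinearMap 𝔪.asIdeal.primeCompl (B ⧸ p.asIdeal)) e.toLinearMap
          e.injective).subsingleton
      rw [Module.length_eq_zero (M := LocalizedModule 𝔪.asIdeal.primeCompl N), mul_zero]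
  | exact N₁ N₂ N₃ f g hf hg hfg h₁ h₃ =>
    intro hN₂
    have hN₁ : IsFiniteLength B N₁ := hN₂.of_injective hf
    have hN₃ : IsFiniteLength B N₃ := hN₂.of_surjective hg
    -- additivity of the localized lengths
    have hB : ∀ 𝔪 : MaximalSpectrum B,
        Module.length B (LocalizedModule 𝔪.asIdeal.primeCompl N₂) =
          Module.length B (LocalizedModule 𝔪.asIdeal.primeCompl N₁) +
            Module.length B (LocalizedModule 𝔪.asIdeal.primeCompl N₃) := fun 𝔪 ↦
      Module.length_eq_add_of_exact
        (IsLocalizedModule.map 𝔪.asIdeal.primeCompl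
          (LocalizedModule.mkLinearMap 𝔪.asIdeal.primeCompl N₁)
          (LocalizedModule.mkLinearMap 𝔪.asIdeal.primeCompl N₂) f)
        (IsLocalizedModule.map 𝔪.asIdeal.primeCompl
          (LocalizedModule.mkLinearMap 𝔪.asIdeal.primeCompl N₂)
          (LocalizedModule.mkLinearMap 𝔪.asIdeal.primeCompl N₃) g)
        (IsLocalizedModule.map_injective _ _ _ _ hf) (IsLocalizedModule.map_surjective _ _ _ _ hg)
        (LocalizedModule.map_exact _ f g hfg)
    rw [length_compHom_eq_add_of_exact f g hf hg hfg, h₁ hN₁, h₃ hN₃,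
      ← finsum_add_distrib (Set.toFinite _) (Set.toFinite _)]
    exact finsum_congr fun 𝔪 ↦ by rw [hB 𝔪, mul_add]

/-- The same formula for a `B`-module carrying a compatible `A`-module structure
(`IsScalarTower A B N`): `ℓ_A(N) = Σ_𝔪 ℓ_A(B ⧸ 𝔪) · ℓ_B(N_𝔪)`
(Fulton, *Intersection Theory*, Lemmas A.1.2–A.1.3). [cite: Fulton1998, Lemma A.1.3] -/
theorem length_eq_finsum_length_localizedModule (N : Type w) [AddCommGroup N] [Module B N]
    [Module A N] [IsScalarTower A B N] (hN : IsFiniteLength B N) :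
    Module.length A N = ∑ᶠ 𝔪 : MaximalSpectrum B,
      Module.length A (B ⧸ 𝔪.asIdeal) *
        Module.length B (LocalizedModule 𝔪.asIdeal.primeCompl N) := by
  rw [← length_compHom_eq (A := A) (B := B) N]
  exact length_compHom_eq_finsum A N hN

end Main

end Literature.RingTheory.Length
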